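import Summits.BirchSwinnertonDyer.BirchSwinnertonDyer.Theses.CMKolyvaginAtInertTwo
import Summits.BirchSwinnertonDyer.BirchSwinnertonDyer.Theorems.CMKolyvaginAtInertTwoPairSupplyStubUpperAtTwo
import HarnessLib

/-! Scratch (bsd-line-cmk2-p1 g18): kernel check of a TURNKEY aside for crux 24277 `CMKolyvaginExactAtInertTwo`
following KERNEL-STATUS §18: the UPPER half (`stub_upper`'s conclusion `#Ш(E_K)(2) ≤ 2^{2M₀}`) on H₂ with PRIME
`|d_K|`, as an `…OfFacts`-shaped class aside on the route's four published inputs (items 24148, 19921, 19273, 24149)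
plus the named fact `GrossLMS1991.prop37_2_reductionCongruence_inert` (Gross 1991 Prop. 3.7 (2)), closable BY NAME
by this seat's `KolyvaginPairSupplyTwo.card_primaryComponent_sha_two_baseChange_le_pow_of_printedInputs` (p733162).
The binders of 24277 are kept VERBATIM (the certificate binders `n`, `d`, … are accepted and unused); two binders are
inserted: `Nat.Prime (NumberField.discr K).natAbs` after `NumberField.discr K ≠ -3`, and the named fact after the
Heegner hypothesis. Nothing is asserted about the crux itself; BSD is not proved by any of this. -/

namespace Scratch.CMKolyvaginAtInertTwoEdit24277Upper

open Summit.BirchSwinnertonDyer.BirchSwinnertonDyer.Theses.CMKolyvaginAtInertTwo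
open Summit.BirchSwinnertonDyer.BirchSwinnertonDyer.Theorems

/-- PROPOSED aside text: the UPPER HALF of 24277 on H₂ with prime `|d_K|`, modulo Gross 1991 Prop. 3.7 (2) by name. -/
def CMKolyvaginUpperAtInertTwoPrime : Prop :=
  ∀ (W : WeierstrassCurve ℚ) [W.IsElliptic] [W.IsGloballyMinimal] [NeZero (W.conductorNorm ℤ)], W.HasCM → Literature.NumberTheory.EllipticCurves.Rank1Residual.CMInert W 2 → W.HasSurjectiveModNGaloisRep (2 : ℤ) → Odd W.tamagawaProduct → ∀ (K : Type) [Field K] [NumberField K], Literature.NumberTheory.EllipticCurves.IsImaginaryQuadratic K → Odd (NumberField.discr K) → NumberField.discr K ≠ -3 → Nat.Prime (NumberField.discr K).natAbs → Literature.NumberTheory.EllipticCurves.SatisfiesHeegnerHypothesis (W.conductorNorm ℤ) K → Literature.NumberTheory.EllipticCurves.GrossLMS1991.prop37_2_reductionCongruence_inert (W.conductorNorm ℤ) W K → ¬ IsSquare ((NumberField.discr K : ℚ) * -|W.Δ|) → ¬ IsSquare ((NumberField.discr K : ℚ) * (-(2 * |W.Δ|))) → ∀ (Dt : Literature.NumberTheory.EllipticCurves.ModularForms.ModularParametrizationData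 W (W.conductorNorm ℤ)) (β : ℤ) (ι : K →+* ℂ) (d₁ : Literature.NumberTheory.EllipticCurves.KolyvaginHeegnerData Dt β ι 1), ¬ IsOfFinAddOrder d₁.derivedPoint → ∀ (M₀ : ℕ), (∃ Q : (W.baseChange (Literature.NumberTheory.EllipticCurves.ringClassField K ι 1)).toAffine.Point, ((2 ^ M₀ : ℕ) : ℤ) • Q = d₁.derivedPoint) → (¬ ∃ Q : (W.baseChange (Literature.NumberTheory.EllipticCurves.ringClassField K ι 1)).toAffine.Point, ((2 ^ (M₀ + 1) : ℕ) : ℤ) • Q = d₁.derivedPoint) → ∀ (n : ℕ) (d : Literature.NumberTheory.EllipticCurves.KolyvaginHeegnerData Dt β ι n), Squarefree n → (∀ ℓ ∈ n.primeFactors, (Literature.NumberTheory.EllipticCurves.Zhang2014.IsKolyvaginPrime (W.conductorNorm ℤ) W K 2 ℓ ∧ Literature.NumberTheory.EllipticCurves.Rank1Residual.CMInert W ℓ)) → (¬ ∃ Q : (W.baseChange (Literature.NumberTheory.EllipticCurves.ringClassField K ι n)).toAffine.Point, (2 : ℤ) • Q = d.derivedPoint) → Nat.card (AddCommGroup.primaryComponent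 (W.baseChange K).sha 2) ≤ 2 ^ (2 * M₀)

/-- PROPOSED `…OfFacts` twin on the route's four published inputs (items 24148, 19921, 19273, 24149). -/
def CMKolyvaginUpperAtInertTwoPrimeOfFacts : Prop :=
  ((∀ (N : ℕ) [NeZero N] (W : WeierstrassCurve ℚ) (K : Type) [Field K] [NumberField K],
      Literature.NumberTheory.EllipticCurves.gross_zagier N W K) ∧
    Literature.NumberTheory.EllipticCurves.rank_eq_analyticRank_of_analyticRank_le_one ∧
    WeierstrassCurve.hasEntireLFunction_rat ∧
    Literature.NumberTheory.EllipticCurves.Milne1972.bsdQuotient_baseChange_quadratic_anyModel) →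
  CMKolyvaginUpperAtInertTwoPrime

/-- THE CLOSER (kernel-checked here): the `…OfFacts` aside BY NAME from p733162. -/
theorem cmKolyvaginUpperAtInertTwoPrimeOfFacts_proof : CMKolyvaginUpperAtInertTwoPrimeOfFacts := by
  rintro ⟨hGZ, hGZK, hmod, hMi⟩ W _ _ _ hCM hin hρ hT K _ _ hK hodd h3 hq hH h372 _ _ Dt β ι d₁ hy M₀ hdiv hndiv
    _ _ _ _ _
  exact KolyvaginPairSupplyTwo.card_primaryComponent_sha_two_baseChange_le_pow_of_printedInputs W hGZ hGZK hmod hMi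
    hCM hin hρ hT hK hodd h3 hH hq h372 Dt β ι d₁ hy M₀ hdiv hndiv

/-- The `stub_upper` shape modulo the aside and the facts: 24277's binders VERBATIM imply the `≤` half whenever
`|d_K|` is prime and Prop. 3.7 (2) is given (sanity: the aside is exactly the restriction of `stub_upper`). -/
theorem stub_upper_of_aside_of_prime (hA : CMKolyvaginUpperAtInertTwoPrime) :
    ∀ (W : WeierstrassCurve ℚ) [W.IsElliptic] [W.IsGloballyMinimal] [NeZero (W.conductorNorm ℤ)], W.HasCM → Literature.NumberTheory.EllipticCurves.Rank1Residual.CMInert W 2 → W.HasSurjectiveModNGaloisRep (2 : ℤ) → Odd W.tamagawaProduct → ∀ (K : Type) [Field K] [NumberField K], Literature.NumberTheory.EllipticCurves.IsImaginaryQuadratic K → Odd (NumberField.discr K) → NumberField.discr K ≠ -3 → Literature.NumberTheory.EllipticCurves.SatisfiesHeegnerHypothesis (W.conductorNorm ℤ) K → ¬ IsSquare ((NumberField.discr K : ℚ) * -|W.Δ|) → ¬ IsSquare ((NumberField.discr K : ℚ) * (-(2 * |W.Δ|))) → ∀ (Dt : Literature.NumberTheory.EllipticCurves.ModularForms.ModularParametrizationData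 W (W.conductorNorm ℤ)) (β : ℤ) (ι : K →+* ℂ) (d₁ : Literature.NumberTheory.EllipticCurves.KolyvaginHeegnerData Dt β ι 1), ¬ IsOfFinAddOrder d₁.derivedPoint → ∀ (M₀ : ℕ), (∃ Q : (W.baseChange (Literature.NumberTheory.EllipticCurves.ringClassField K ι 1)).toAffine.Point, ((2 ^ M₀ : ℕ) : ℤ) • Q = d₁.derivedPoint) → (¬ ∃ Q : (W.baseChange (Literature.NumberTheory.EllipticCurves.ringClassField K ι 1)).toAffine.Point, ((2 ^ (M₀ + 1) : ℕ) : ℤ) • Q = d₁.derivedPoint) → ∀ (n : ℕ) (d : Literature.NumberTheory.EllipticCurves.KolyvaginHeegnerData Dt β ι n), Squarefree n → (∀ ℓ ∈ n.primeFactors, (Literature.NumberTheory.EllipticCurves.Zhang2014.IsKolyvaginPrime (W.conductorNorm ℤ) W K 2 ℓ ∧ Literature.NumberTheory.EllipticCurves.Rank1Residual.CMInert W ℓ)) → (¬ ∃ Q : (W.baseChange (Literature.NumberTheory.EllipticCurves.ringClassField K ι n)).toAffine.Point, (2 : ℤ) • Q = d.derivedPoint) →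
      Nat.Prime (NumberField.discr K).natAbs →
      Literature.NumberTheory.EllipticCurves.GrossLMS1991.prop37_2_reductionCongruence_inert (W.conductorNorm ℤ) W K →
      Nat.card (AddCommGroup.primaryComponent (W.baseChange K).sha 2) ≤ 2 ^ (2 * M₀) := by
  intro W _ _ _ hCM hin hρ hT K _ _ hK hodd h3 hH hs1 hs2 Dt β ι d₁ hy M₀ hdiv hndiv n d hn hKol hPn hq h372
  exact hA W hCM hin hρ hT K hK hodd h3 hq hH h372 hs1 hs2 Dt β ι d₁ hy M₀ hdiv hndiv n d hn hKol hPn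

/-- PROPOSED companion aside: the LOWER half on the same sub-habitat and with the same named fact displayed (the port of
gk2's LINE 18, KERNEL-STATUS §16.2 — NOT proved here). -/
def CMKolyvaginLowerAtInertTwoPrime : Prop :=
  ∀ (W : WeierstrassCurve ℚ) [W.IsElliptic] [W.IsGloballyMinimal] [NeZero (W.conductorNorm ℤ)], W.HasCM → Literature.NumberTheory.EllipticCurves.Rank1Residual.CMInert W 2 → W.HasSurjectiveModNGaloisRep (2 : ℤ) → Odd W.tamagawaProduct → ∀ (K : Type) [Field K] [NumberField K], Literature.NumberTheory.EllipticCurves.IsImaginaryQuadratic K → Odd (NumberField.discr K) → NumberField.discr K ≠ -3 → Nat.Prime (NumberField.discr K).natAbs → Literature.NumberTheory.EllipticCurves.SatisfiesHeegnerHypothesis (W.conductorNorm ℤ) K → Literature.NumberTheory.EllipticCurves.GrossLMS1991.prop37_2_reductionCongruence_inert (W.conductorNorm ℤ) W K → ¬ IsSquare ((NumberField.discr K : ℚ) * -|W.Δ|) → ¬ IsSquare ((NumberField.discr K : ℚ) * (-(2 * |W.Δ|))) → ∀ (Dt : Literature.NumberTheory.EllipticCurves.ModularForms.ModularParametrizationData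 W (W.conductorNorm ℤ)) (β : ℤ) (ι : K →+* ℂ) (d₁ : Literature.NumberTheory.EllipticCurves.KolyvaginHeegnerData Dt β ι 1), ¬ IsOfFinAddOrder d₁.derivedPoint → ∀ (M₀ : ℕ), (∃ Q : (W.baseChange (Literature.NumberTheory.EllipticCurves.ringClassField K ι 1)).toAffine.Point, ((2 ^ M₀ : ℕ) : ℤ) • Q = d₁.derivedPoint) → (¬ ∃ Q : (W.baseChange (Literature.NumberTheory.EllipticCurves.ringClassField K ι 1)).toAffine.Point, ((2 ^ (M₀ + 1) : ℕ) : ℤ) • Q = d₁.derivedPoint) → ∀ (n : ℕ) (d : Literature.NumberTheory.EllipticCurves.KolyvaginHeegnerData Dt β ι n), Squarefree n → (∀ ℓ ∈ n.primeFactors, (Literature.NumberTheory.EllipticCurves.Zhang2014.IsKolyvaginPrime (W.conductorNorm ℤ) W K 2 ℓ ∧ Literature.NumberTheory.EllipticCurves.Rank1Residual.CMInert W ℓ)) → (¬ ∃ Q : (W.baseChange (Literature.NumberTheory.EllipticCurves.ringClassField K ι n)).toAffine.Point, (2 : ℤ) • Q = d.derivedPoint) → 2 ^ (2 * M₀) ≤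 Nat.card (AddCommGroup.primaryComponent (W.baseChange K).sha 2)

/-- The EXACT statement on the sub-habitat (24277's binders VERBATIM + prime `|d_K|` + Prop. 3.7 (2) by name; conclusion `=`) —
the shape of g15's TURNKEY v1 `CMKolyvaginExactAtInertTwoPrime` with the named fact displayed. -/
def CMKolyvaginExactAtInertTwoPrimeNamed : Prop :=
  ∀ (W : WeierstrassCurve ℚ) [W.IsElliptic] [W.IsGloballyMinimal] [NeZero (W.conductorNorm ℤ)], W.HasCM → Literature.NumberTheory.EllipticCurves.Rank1Residual.CMInert W 2 → W.HasSurjectiveModNGaloisRep (2 : ℤ) → Odd W.tamagawaProduct → ∀ (K : Type) [Field K] [NumberField K], Literature.NumberTheory.EllipticCurves.IsImaginaryQuadratic K → Odd (NumberField.discr K) → NumberField.discr K ≠ -3 → Nat.Prime (NumberField.discr K).natAbs → Literature.NumberTheory.EllipticCurves.SatisfiesHeegnerHypothesis (W.conductorNorm ℤ) K → Literature.NumberTheory.EllipticCurves.GrossLMS1991.prop37_2_reductionCongruence_inert (W.conductorNorm ℤ) W K → ¬ IsSquare ((NumberField.discr K : ℚ) * -|W.Δ|) → ¬ IsSquare ((NumberField.discr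 K : ℚ) * (-(2 * |W.Δ|))) → ∀ (Dt : Literature.NumberTheory.EllipticCurves.ModularForms.ModularParametrizationData W (W.conductorNorm ℤ)) (β : ℤ) (ι : K →+* ℂ) (d₁ : Literature.NumberTheory.EllipticCurves.KolyvaginHeegnerData Dt β ι 1), ¬ IsOfFinAddOrder d₁.derivedPoint → ∀ (M₀ : ℕ), (∃ Q : (W.baseChange (Literature.NumberTheory.EllipticCurves.ringClassField K ι 1)).toAffine.Point, ((2 ^ M₀ : ℕ) : ℤ) • Q = d₁.derivedPoint) → (¬ ∃ Q : (W.baseChange (Literature.NumberTheory.EllipticCurves.ringClassField K ι 1)).toAffine.Point, ((2 ^ (M₀ + 1) : ℕ) : ℤ) • Q = d₁.derivedPoint) → ∀ (n : ℕ) (d : Literature.NumberTheory.EllipticCurves.KolyvaginHeegnerData Dt β ι n), Squarefree n → (∀ ℓ ∈ n.primeFactors, (Literature.NumberTheory.EllipticCurves.Zhang2014.IsKolyvaginPrime (W.conductorNorm ℤ) W K 2 ℓ ∧ Literature.NumberTheory.EllipticCurves.Rank1Residual.CMInert W ℓ)) → (¬ ∃ Q : (W.baseChange (Literature.NumberTheory.EllipticCurves.ringClassField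 K ι n)).toAffine.Point, (2 : ℤ) • Q = d.derivedPoint) → Nat.card (AddCommGroup.primaryComponent (W.baseChange K).sha 2) = 2 ^ (2 * M₀)

/-- GLUE (kernel-checked): upper ∧ lower ⟹ exact on the sub-habitat — so the pen may file the two halves as split children of a
prime-`|d_K|` exactness crux and book the upper half NOW by p733162. -/
theorem exactPrimeNamed_of_upper_of_lower (hU : CMKolyvaginUpperAtInertTwoPrime) (hL : CMKolyvaginLowerAtInertTwoPrime) :
    CMKolyvaginExactAtInertTwoPrimeNamed := by
  intro W _ _ _ hCM hin hρ hT K _ _ hK hodd h3 hq hH h372 hs1 hs2 Dt β ι d₁ hy M₀ hdiv hndiv n d hn hKol hPn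
  exact le_antisymm (hU W hCM hin hρ hT K hK hodd h3 hq hH h372 hs1 hs2 Dt β ι d₁ hy M₀ hdiv hndiv n d hn hKol hPn)
    (hL W hCM hin hρ hT K hK hodd h3 hq hH h372 hs1 hs2 Dt β ι d₁ hy M₀ hdiv hndiv n d hn hKol hPn)

end Scratch.CMKolyvaginAtInertTwoEdit24277Upper
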